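/-
Copyright (c) 2026 the pub-hodgecm-mathlib formalisation cell (harness21).  Prover seat hodgecm-mathlib-B-p14 (g30), (L3) second pen under A-p03 (g24);
LEAD F0P3a-plan (g9) WORD T8-36 (C) «(L3)», architect A-p06 (g26) (MAP v2 WANT 2–5), 2026-09-01.
-/
import Literature.NumberTheory.Rogawski1990.UnitOrbitalIntegralInertClosedFormsTypeTwo   -- the printed closed forms `phiTH` ∕ `phiTHprime` ∕ `phiHtwo` ∕ `phiKappaTwo` (this seat)
import Literature.NumberTheory.Rogawski1990.UnitFundamentalLemmaInertFlickerAlgebra       -- ★ A-p03 (g24): `cast_sub_one_ne_zero`, `cast_pow_four_sub_one_ne_zero` (type (1), Theorem 15)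
import Mathlib.Analysis.Complex.Basic                                                    -- (ED. 2) the `ℂ`-valued `halg` shape
import HarnessLib

/-!
# Flicker's elementary unit fundamental lemma for `U(3)` at an inert place, TORUS TYPE (2) `T ≃ (EL)¹ × E¹` — THE ALGEBRA
# (Canad. J. Math. 50 (1998), Theorem 18 p. 97 from Prop. 11 (second half) p. 87 and Props. 16–17 pp. 96–97)

Topic `NumberTheory/Rogawski1990` (road «D-N7-inert», letter N7-ns = [Rogawski1990, Prop. 4.9.1 (b)] at the inert places — here Rogawski's «other»
endoscopic torus `T_K × E¹`); namespace `Literature.NumberTheory.Rogawski1990.Flicker1998`.  KERNEL lane: THEOREMS ONLY (no `def` — the closed forms are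
★ `UnitOrbitalIntegralInertClosedFormsTypeTwo`; no instance, no notation, no named fact, no `sorry`).  Companion of ★ `UnitFundamentalLemmaInertFlickerAlgebra`
(A-p03 (g24), type (1), Theorem 15).  Cell `pub/hodgecm-mathlib`, crux H413 = `stmt-HodgeConjecture-24833`.

THE MATHEMATICS [Flicker1998UnitaryFL] (notation of the companion defs file): `t = (t₁, 1) ∈ T_H ≃ (EL)¹ × E¹` regular, invariants `N` (`α = Bπ^N`) and `N₂`
(`δ₂ = D₂π^{1+N₂}`), `n = min(1 + 2N, 2 + 2N₂)` (`t₁ − 1 ∈ π_{EL}^n R_{EL}^×`), transfer factor `Δ_{G∕H}(t) = (−q)^{−n}`, `Φ^κ_{1_K}(t) = Φ(t) − Φ′(t)` with `Φ`, `Φ′`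
the closed forms of Prop. 11 (second half) and Prop. 17, `Φ^st_{1_{K_H}}(t) = Φ_H(t) = (q^{N+1} − 1)∕(q − 1)`.
* §1 the denominator `q² + 1 ≠ 0`;
* §2 the two order cases of the proof of Theorem 18 (p. 97): `N ≤ N₂ ⇒ Φ^κ = −q^{1+2N} Φ_H` (`phiKappaTwo_eq_of_le`) and `N₂ < N ⇒ Φ^κ = q^{2+2N₂} Φ_H`
  (`phiKappaTwo_eq_of_lt`), each by the parity of `N` resp. `N₂` and `field_simp; ring`;
* §3 **THEOREM 18** `flicker_theorem18 : phiKappaTwo q N₂ N = (−q)^{min(1+2N, 2+2N₂)} · phiHtwo q N` for ALL `N, N₂ : ℕ` and `q > 1` (no side condition —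
  unlike type (1), where the two smallest of `N₁, N₂, N` must agree), and the transfer-factor form `flicker_theorem18_div`;
* §4 **PROPOSITION 17 FROM PROPOSITION 16** (p. 97, the two geometric sums): `phiTHprime q N₂ N = Σ_{0 ≤ m ≤ min([N∕2],[N₂∕2])} (q+1)q^{4m} +
  δ(N ≤ N₂) Σ_{[N∕2] < m ≤ N} (q+1)q^{N+2m}` (`phiTHprime_eq_sum`), the summands being Prop. 16's values `(q+1)q^{4m}` (`0 ≤ m ≤ min`) and `(q+1)q^{N+2m}`
  (`N ≤ N₂`, `[N∕2] < m ≤ N`) of `∫_{H′∕H′_m} 1_{H′_m}(h⁻¹t′h) dh`.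
The file is (a) Flicker's Theorem 18 ∕ Prop. 17 in the tree and (b) the CONSISTENCY CERTIFICATE of the cell's transcription of the printed constants of Prop. 11
(second half) and Prop. 17 (a wrong parity pairing or floor would break the polynomial identity); the orbital-integral VALUES — the lattice counts — are the
letter «(L3-V)», cited not proved; this file asserts nothing about orbital integrals.
HONEST LABEL: HC_CM is proved only modulo the printed citations until rung 0 closes; this file is arithmetic and pays no letter by itself.

## References
* [Flicker1998UnitaryFL] Y. Z. Flicker, *Elementary proof of the fundamental lemma for a unitary group*, Canad. J. Math. 50 (1998), 74–98: Prop. 11 p. 87, Prop. 16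
  p. 96, Prop. 17 and Theorem 18 p. 97.
* [Rogawski1990] J. D. Rogawski, *Automorphic Representations of Unitary Groups in Three Variables*, Ann. of Math. Stud. 123 (1990), §4.9 Prop. 4.9.1 (b) p. 55.
* [BlasiusRogawski1992FL] D. Blasius, J. D. Rogawski, *Fundamental lemmas for U(3) and related groups*, CRM Montréal (1992), 363–394.
-/

set_option autoImplicit false

open Finset

namespace Literature.NumberTheory.Rogawski1990.Flicker1998

/-! ## §1 The printed denominators -/

variable {q : ℕ}

/-- `q² + 1 ≠ 0` in `ℚ`. [cite: Flicker1998UnitaryFL, Prop. 11 p. 87] -/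
theorem cast_sq_add_one_ne_zero (q : ℕ) : (q : ℚ) ^ 2 + 1 ≠ 0 := by positivity

/-! ## §2 The two order cases (Flicker p. 97, proof of Theorem 18) -/

/-- **Case `N ≤ N₂`** (p. 97: «if `N ≤ N₂`, we then need to show that `Φ^κ_{1_K}(t) = −q^{1+2N}(q^{N+1} − 1)∕(q − 1)`»): on the closed forms,
`φ_{T_H}(N₂,N) − φ′_{T_H}(N₂,N) = −q^{1+2N} · (q^{N+1} − 1)∕(q − 1)`, by the parity of `N` (Prop. 11 (1)) — here `min([N∕2],[N₂∕2]) = [N∕2]`.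
[cite: Flicker1998UnitaryFL, Theorem 18 p. 97] -/
theorem phiKappaTwo_eq_of_le (hq : 1 < q) {N₂ N : ℕ} (h : N ≤ N₂) :
    phiKappaTwo q N₂ N = -(q : ℚ) ^ (1 + 2 * N) * phiHtwo q N := by
  have h1 := cast_sub_one_ne_zero hq
  have h2 := cast_sq_add_one_ne_zero q
  simp only [phiKappaTwo, phiTH, phiTHprime, phiHtwo, if_pos h, min_eq_left (Nat.div_le_div_right h)]
  obtain ⟨a, rfl | rfl⟩ := Nat.even_or_odd' N
  · -- N = 2a
    have e1 : ¬ (2 * a) % 2 = 1 := by omega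
    have e3 : 2 * a / 2 = a := by omega
    rw [if_neg e1, e3]
    field_simp
    ring
  · -- N = 2a+1
    have e1 : (2 * a + 1) % 2 = 1 := by omega
    have e3 : (2 * a + 1) / 2 = a := by omega
    rw [if_pos e1, e3]
    field_simp
    ring

/-- **Case `N₂ < N`** (p. 97: «when `N₂ < N`, we have to show that `Φ^κ_{1_K}(t) = q^{2+2N₂}(q^{N+1} − 1)∕(q − 1)`»): on the closed forms,
`φ_{T_H}(N₂,N) − φ′_{T_H}(N₂,N) = q^{2+2N₂} · (q^{N+1} − 1)∕(q − 1)`, by the parity of `N₂` (Prop. 11 (2)) — here `min([N∕2],[N₂∕2]) = [N₂∕2]` and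
the `δ(N ≤ N₂)` term of Prop. 17 is absent.  [cite: Flicker1998UnitaryFL, Theorem 18 p. 97] -/
theorem phiKappaTwo_eq_of_lt (hq : 1 < q) {N₂ N : ℕ} (h : N₂ < N) :
    phiKappaTwo q N₂ N = (q : ℚ) ^ (2 + 2 * N₂) * phiHtwo q N := by
  have h1 := cast_sub_one_ne_zero hq
  have h2 := cast_sq_add_one_ne_zero q
  simp only [phiKappaTwo, phiTH, phiTHprime, phiHtwo, if_neg (not_le.2 h), min_eq_right (Nat.div_le_div_right h.le), add_zero]
  obtain ⟨b, rfl | rfl⟩ := Nat.even_or_odd' N₂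
  · -- N₂ = 2b
    have e1 : (2 * b) % 2 = 0 := by omega
    have e3 : 2 * b / 2 = b := by omega
    rw [if_pos e1, e3]
    field_simp
    ring
  · -- N₂ = 2b+1
    have e1 : ¬ (2 * b + 1) % 2 = 0 := by omega
    have e3 : (2 * b + 1) / 2 = b := by omega
    rw [if_neg e1, e3]
    field_simp
    ring

/-! ## §3 Theorem 18 -/

/-- **FLICKER'S THEOREM 18 (the unit fundamental lemma for `U(3)` at an inert place, torus type (2) `T_H ≃ (EL)¹ × E¹`, algebraic form)**: for ALL
`N, N₂ ≥ 0` and `q > 1`, `Φ^κ_{1_K}(t) = (−q)^{n} Φ^st_{1_{K_H}}(t)` on the printed closed forms, `n = min(1 + 2N, 2 + 2N₂)`: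
`φ_{T_H}(N₂,N) − φ′_{T_H}(N₂,N) = (−q)^{min(1+2N, 2+2N₂)} · (q^{N+1} − 1)∕(q − 1)`.  [cite: Flicker1998UnitaryFL, Theorem 18 p. 97] -/
theorem flicker_theorem18 (hq : 1 < q) (N₂ N : ℕ) :
    phiKappaTwo q N₂ N = (-(q : ℚ)) ^ min (1 + 2 * N) (2 + 2 * N₂) * phiHtwo q N := by
  rcases Nat.lt_or_ge N₂ N with h | h
  · -- `N₂ < N`
    rw [min_eq_right (by omega), phiKappaTwo_eq_of_lt hq h,
      show (-(q : ℚ)) ^ (2 + 2 * N₂) = (q : ℚ) ^ (2 + 2 * N₂) from Even.neg_pow ⟨1 + N₂, by ring⟩ _]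
  · -- `N ≤ N₂`
    rw [min_eq_left (by omega), phiKappaTwo_eq_of_le hq h,
      show (-(q : ℚ)) ^ (1 + 2 * N) = -(q : ℚ) ^ (1 + 2 * N) from Odd.neg_pow ⟨N, by ring⟩ _]

/-- **THEOREM 18 in transfer-factor form**: `Δ_{G∕H}(t)·Φ^κ_{1_K}(t) = Φ^st_{1_{K_H}}(t)` with `Δ_{G∕H}(t) = (−q)^{−n}`, `n = min(1 + 2N, 2 + 2N₂)`, read on the
closed forms.  [cite: Flicker1998UnitaryFL, Theorem 18 p. 97] -/
theorem flicker_theorem18_div (hq : 1 < q) (N₂ N : ℕ) :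
    ((-(q : ℚ)) ^ min (1 + 2 * N) (2 + 2 * N₂))⁻¹ * phiKappaTwo q N₂ N = phiHtwo q N := by
  have hq0 : (-(q : ℚ)) ^ min (1 + 2 * N) (2 + 2 * N₂) ≠ 0 :=
    pow_ne_zero _ (neg_ne_zero.2 (by exact_mod_cast (by omega : q ≠ 0)))
  rw [flicker_theorem18 hq N₂ N, ← mul_assoc, inv_mul_cancel₀ hq0, one_mul]

/-- **The sign of `Δ_{G∕H}` at type (2)**: `(−q)^{min(1+2N, 2+2N₂)} = −q^{1+2N}` if `N ≤ N₂` and `= q^{2+2N₂}` if `N₂ < N` — i.e. `Δ_{G∕H}(t) = −q^{−1−2N}`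
resp. `q^{−2−2N₂}` (p. 97).  [cite: Flicker1998UnitaryFL, Theorem 18 p. 97] -/
theorem neg_cast_pow_min_eq (q N₂ N : ℕ) :
    (-(q : ℚ)) ^ min (1 + 2 * N) (2 + 2 * N₂) = if N ≤ N₂ then -(q : ℚ) ^ (1 + 2 * N) else (q : ℚ) ^ (2 + 2 * N₂) := by
  split_ifs with h
  · rw [min_eq_left (by omega)]
    exact Odd.neg_pow ⟨N, by ring⟩ _
  · rw [min_eq_right (by omega)]
    exact Even.neg_pow ⟨1 + N₂, by ring⟩ _

/-! ## §4 Proposition 17 from Proposition 16 (the two geometric sums, p. 97) -/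

/-- The first geometric sum of the proof of Prop. 17: `Σ_{0 ≤ m ≤ M} (q+1) q^{4m} = (q^{4+4M} − 1)∕((q²+1)(q−1))`.
[cite: Flicker1998UnitaryFL, Prop. 17 p. 97 (proof)] -/
theorem sum_range_succ_mul_pow_four_mul (hq : 1 < q) (M : ℕ) :
    ∑ m ∈ range (M + 1), ((q : ℚ) + 1) * (q : ℚ) ^ (4 * m) = ((q : ℚ) ^ (4 + 4 * M) - 1) / (((q : ℚ) ^ 2 + 1) * ((q : ℚ) - 1)) := by
  have h1 := cast_sub_one_ne_zero hq
  have h2 := cast_sq_add_one_ne_zero q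
  have h4 := cast_pow_four_sub_one_ne_zero hq
  have hq4 : (q : ℚ) ^ 4 ≠ 1 := fun h => h4 (by rw [h, sub_self])
  rw [← mul_sum]
  simp_rw [pow_mul]
  rw [geom_sum_eq hq4, ← pow_mul, show 4 * (M + 1) = 4 + 4 * M by ring]
  have : ((q : ℚ) ^ 2 + 1) * ((q : ℚ) - 1) * ((q : ℚ) + 1) = (q : ℚ) ^ 4 - 1 := by ring
  field_simp
  rw [← this]
  ring

/-- The second geometric sum of the proof of Prop. 17: `Σ_{[N∕2] < m ≤ N} (q+1) q^{N+2m} = q^N (q^{2N+2} − q^{2[N∕2]+2})∕(q − 1)`.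
[cite: Flicker1998UnitaryFL, Prop. 17 p. 97 (proof)] -/
theorem sum_Ioc_div_two_mul_pow (hq : 1 < q) (N : ℕ) :
    ∑ m ∈ Ioc (N / 2) N, ((q : ℚ) + 1) * (q : ℚ) ^ (N + 2 * m) =
      (q : ℚ) ^ N * ((q : ℚ) ^ (2 * N + 2) - (q : ℚ) ^ (2 * (N / 2) + 2)) / ((q : ℚ) - 1) := by
  have h1 := cast_sub_one_ne_zero hq
  have hq1 : (1 : ℚ) < q := by exact_mod_cast hq
  have hq2 : (q : ℚ) ^ 2 ≠ 1 := ne_of_gt (one_lt_pow₀ hq1 (by norm_num))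
  -- reindex `Ioc (N/2) N = Ico (N/2 + 1) (N + 1)` and shift to `range (N - N/2)`
  rw [← Finset.Ico_add_one_add_one_eq_Ioc, sum_Ico_eq_sum_range, show N + 1 - (N / 2 + 1) = N - N / 2 by omega, ← mul_sum]
  have hterm : ∀ k : ℕ, (q : ℚ) ^ (N + 2 * (N / 2 + 1 + k)) = (q : ℚ) ^ (N + 2 * (N / 2) + 2) * ((q : ℚ) ^ 2) ^ k := by
    intro k
    rw [← pow_mul, ← pow_add]
    congr 1
    ring
  simp_rw [hterm]
  rw [← mul_sum, geom_sum_eq hq2, ← pow_mul]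
  -- parity of `N` to make the exponents explicit
  obtain ⟨a, rfl | rfl⟩ := Nat.even_or_odd' N
  · have e3 : 2 * a / 2 = a := by omega
    have e4 : 2 * a - a = a := by omega
    rw [e3, e4]
    have : ((q : ℚ) - 1) * ((q : ℚ) + 1) = (q : ℚ) ^ 2 - 1 := by ring
    have h21 : (q : ℚ) ^ 2 - 1 ≠ 0 := sub_ne_zero.2 hq2
    field_simp
    ring
  · have e3 : (2 * a + 1) / 2 = a := by omega
    have e4 : 2 * a + 1 - a = a + 1 := by omega
    rw [e3, e4]
    have h21 : (q : ℚ) ^ 2 - 1 ≠ 0 := sub_ne_zero.2 hq2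
    field_simp
    ring

/-- **PROPOSITION 17 FROM PROPOSITION 16** (p. 97: «The integral is equal to `Σ_{0 ≤ m ≤ min} (q+1)q^{4m} + δ(N ≤ N₂) Σ_{[N∕2] < m ≤ N} (q+1)q^{N+2m}`, which is equal to
the asserted expressions»): the printed closed form `φ′_{T_H}(N₂, N)` IS that sum of Prop. 16's values of `∫_{H′∕H′_m} 1_{H′_m}(h⁻¹t′h) dh`
(`(q+1)q^{4m}` for `0 ≤ m ≤ min([N∕2],[N₂∕2])`, `(q+1)q^{N+2m}` for `N ≤ N₂` and `[N∕2] < m ≤ N`, zero otherwise).  [cite: Flicker1998UnitaryFL, Props. 16–17 pp. 96–97] -/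
theorem phiTHprime_eq_sum (hq : 1 < q) (N₂ N : ℕ) :
    phiTHprime q N₂ N = (∑ m ∈ range (min (N / 2) (N₂ / 2) + 1), ((q : ℚ) + 1) * (q : ℚ) ^ (4 * m)) +
      (if N ≤ N₂ then ∑ m ∈ Ioc (N / 2) N, ((q : ℚ) + 1) * (q : ℚ) ^ (N + 2 * m) else 0) := by
  rw [sum_range_succ_mul_pow_four_mul hq, phiTHprime]
  split_ifs with h
  · rw [sum_Ioc_div_two_mul_pow hq]
  · rfl

/-! ## §5 (ED. 2) The `halg` input of the line edition: Theorem 18 cast to `ℂ` against the transfer-factor exponent -/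

/-- **THEOREM 18 AS THE `halg` HYPOTHESIS of ★ `stableOrbitalIntegralRel_eq_finsum_delta_of_irreducible_of_values`** (`ℂ`-valued, (D2)'s shape
`(−q)^{m}` with `q : ℕ` the residue cardinality and `m = −n`, `n = min(1+2N, 2+2N₂)` the exponent supplied by the (S0′) dictionary
`WithZero.log (Valued.v (χ_g(u))_w) = −n`): `(−q)^{m} · (φ_{T_H} − φ′_{T_H}) = Φ_H`.  [cite: Flicker1998UnitaryFL, Theorem 18 p. 97] -/
theorem flicker_theorem18_halg (hq : 1 < q) (N₂ N : ℕ) {m : ℤ} (hm : m = -((min (1 + 2 * N) (2 + 2 * N₂) : ℕ) : ℤ)) :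
    (-(q : ℂ)) ^ m * (((phiTH q N₂ N : ℚ) : ℂ) - ((phiTHprime q N₂ N : ℚ) : ℂ)) = ((phiHtwo q N : ℚ) : ℂ) := by
  subst hm
  have h := congrArg (fun x : ℚ => (x : ℂ)) (flicker_theorem18_div hq N₂ N)
  simp only [phiKappaTwo, Rat.cast_mul, Rat.cast_inv, Rat.cast_pow, Rat.cast_neg, Rat.cast_natCast, Rat.cast_sub] at h
  rw [zpow_neg, zpow_natCast]
  exact h

/-- The same with the exponent as a natural-number power: `((−q)^n)⁻¹ · (φ_{T_H} − φ′_{T_H}) = Φ_H` in `ℂ`, `n = min(1+2N, 2+2N₂)`.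
[cite: Flicker1998UnitaryFL, Theorem 18 p. 97] -/
theorem flicker_theorem18_div_complex (hq : 1 < q) (N₂ N : ℕ) :
    ((-(q : ℂ)) ^ min (1 + 2 * N) (2 + 2 * N₂))⁻¹ * (((phiTH q N₂ N : ℚ) : ℂ) - ((phiTHprime q N₂ N : ℚ) : ℂ)) = ((phiHtwo q N : ℚ) : ℂ) := by
  have h := congrArg (fun x : ℚ => (x : ℂ)) (flicker_theorem18_div hq N₂ N)
  simp only [phiKappaTwo, Rat.cast_mul, Rat.cast_inv, Rat.cast_pow, Rat.cast_neg, Rat.cast_natCast, Rat.cast_sub] at h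
  exact h

/-! ## §6 (ED. 3) Theorem 18 on the `(M, N)`-indexed total closed forms (`M = N₂ + 1 ≥ 0`), including the boundary stratum `M = 0` -/

/-- Agreement with the printed indexing for `M ≥ 1`: `phiTHM q (N₂+1) N = phiTH q N₂ N`. [cite: Flicker1998UnitaryFL, Prop. 11 p. 87] -/
theorem phiTHM_succ (q N₂ N : ℕ) : phiTHM q (N₂ + 1) N = phiTH q N₂ N := by
  unfold phiTHM phiTH
  by_cases h : N ≤ N₂
  · rw [if_pos (Nat.lt_succ_of_le h), if_pos h]
  · rw [if_neg (by omega), if_neg h]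
    obtain ⟨b, rfl | rfl⟩ := Nat.even_or_odd' N₂
    · rw [if_pos (by omega : (2 * b + 1) % 2 = 1), if_pos (by omega : (2 * b) % 2 = 0)]
      ring_nf
    · rw [if_neg (by omega : ¬ (2 * b + 1 + 1) % 2 = 1), if_neg (by omega : ¬ (2 * b + 1) % 2 = 0)]
      ring_nf

/-- Agreement with the printed indexing for `M ≥ 1`: `phiTHprimeM q (N₂+1) N = phiTHprime q N₂ N`. [cite: Flicker1998UnitaryFL, Prop. 17 p. 97] -/
theorem phiTHprimeM_succ (q N₂ N : ℕ) : phiTHprimeM q (N₂ + 1) N = phiTHprime q N₂ N := by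
  unfold phiTHprimeM phiTHprime
  have hK : min (N / 2 + 1) ((N₂ + 1 + 1) / 2) = min (N / 2) (N₂ / 2) + 1 := by omega
  rw [hK, show 4 * (min (N / 2) (N₂ / 2) + 1) = 4 + 4 * min (N / 2) (N₂ / 2) by ring]
  by_cases h : N ≤ N₂
  · rw [if_pos (Nat.lt_succ_of_le h), if_pos h]
  · rw [if_neg (by omega), if_neg h]

/-- **The boundary stratum `M = 0`**: `φ_{T_H} = (q^{N+1} − 1)∕(q − 1) = Φ_H` and `φ′_{T_H} = 0` (only the `m = 0` terms of Prop. 10 survive; Prop. 16 has no solution).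
[cite: Flicker1998UnitaryFL, Prop. 10 p. 85; Prop. 16 p. 96; p. 97] -/
theorem phiTHM_zero_left (hq : 1 < q) (N : ℕ) : phiTHM q 0 N = phiHtwo q N ∧ phiTHprimeM q 0 N = 0 := by
  have h1 := cast_sub_one_ne_zero hq
  have h2 := cast_sq_add_one_ne_zero q
  refine ⟨?_, ?_⟩
  · simp only [phiTHM, phiHtwo, Nat.not_lt_zero, if_false, Nat.zero_mod, zero_ne_one, mul_zero, add_zero, zero_add, pow_zero]
    field_simp
  · simp only [phiTHprimeM, Nat.not_lt_zero, if_false, add_zero, Nat.zero_add, Nat.reduceDiv, zero_le, min_eq_right, mul_zero,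
      pow_zero, sub_self, zero_div]

/-- **THEOREM 18 ON ALL OF `ℕ²`** (`(M, N)`-indexing, `M = N₂ + 1`): `φ_{T_H}(M, N) − φ′_{T_H}(M, N) = (−q)^{min(2N+1, 2M)} · Φ_H(N)` — for `M ≥ 1` this is ★
`flicker_theorem18` (`min(1+2N, 2+2N₂)`), for `M = 0` it reads `Φ_H − 0 = (−q)^0 · Φ_H`.  [cite: Flicker1998UnitaryFL, Theorem 18 p. 97] -/
theorem flicker_theorem18M (hq : 1 < q) (M N : ℕ) :
    phiTHM q M N - phiTHprimeM q M N = (-(q : ℚ)) ^ min (2 * N + 1) (2 * M) * phiHtwo q N := by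
  rcases M with _ | N₂
  · obtain ⟨h0, h0'⟩ := phiTHM_zero_left hq N
    rw [h0, h0', sub_zero, mul_zero, Nat.min_zero, pow_zero, one_mul]
  · rw [phiTHM_succ, phiTHprimeM_succ, ← phiKappaTwo, flicker_theorem18 hq N₂ N,
      show min (1 + 2 * N) (2 + 2 * N₂) = min (2 * N + 1) (2 * (N₂ + 1)) by ring_nf]

/-- **THEOREM 18 AS THE `halg` HYPOTHESIS, `(M, N)`-indexed** (`ℂ`-valued, (D2)'s shape `(−q)^{m}`, `m = −n`, `n = min(2N+1, 2M) = ord_w χ_g(u)`): `(−q)^m · (φ_{T_H} − φ′_{T_H}) = Φ_H`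
for ALL `M, N`.  [cite: Flicker1998UnitaryFL, Theorem 18 p. 97] -/
theorem flicker_theorem18M_halg (hq : 1 < q) (M N : ℕ) {m : ℤ} (hm : m = -((min (2 * N + 1) (2 * M) : ℕ) : ℤ)) :
    (-(q : ℂ)) ^ m * (((phiTHM q M N : ℚ) : ℂ) - ((phiTHprimeM q M N : ℚ) : ℂ)) = ((phiHtwo q N : ℚ) : ℂ) := by
  subst hm
  have hq0 : (-(q : ℂ)) ≠ 0 := neg_ne_zero.2 (by exact_mod_cast (by omega : q ≠ 0))
  have h := congrArg (fun x : ℚ => (x : ℂ)) (flicker_theorem18M hq M N)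
  simp only [Rat.cast_sub, Rat.cast_mul, Rat.cast_pow, Rat.cast_neg, Rat.cast_natCast] at h
  rw [zpow_neg, zpow_natCast, h, ← mul_assoc, inv_mul_cancel₀ (pow_ne_zero _ hq0), one_mul]

/-! ## §7 (ED. 3) Theorem 18 indexed by the OBSERVABLE exponents `(n, N)` (`n = ord_w χ_g(u)`, `ord_w disc χ_g = 2N+1`; law: `n ≤ 2N+1`, `n` even or `n = 2N+1`) -/

/-- **THEOREM 18 in the observable exponents**: if `n ≤ 2N + 1` and (`n` even or `n = 2N + 1`) then `φ_{T_H}(n, N) − φ′_{T_H}(n, N) = (−q)^n · Φ_H(N)` — over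
`flicker_theorem18M` at `M := n∕2` (even case, `min(2N+1, 2M) = n`) resp. `M := N + 1` (`n = 2N + 1`, `min(2N+1, 2N+2) = n`).  [cite: Flicker1998UnitaryFL, Theorem 18 p. 97] -/
theorem flicker_theorem18n (hq : 1 < q) {n N : ℕ} (hnN : n ≤ 2 * N + 1) (hpar : Even n ∨ n = 2 * N + 1) :
    phiTHn q n N - phiTHprimen q n N = (-(q : ℚ)) ^ n * phiHtwo q N := by
  unfold phiTHn phiTHprimen
  by_cases he : n % 2 = 0
  · rw [if_pos he, flicker_theorem18M hq, show min (2 * N + 1) (2 * (n / 2)) = n by omega]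
  · have hn : n = 2 * N + 1 := by
      rcases hpar with ⟨k, hk⟩ | h
      · omega
      · exact h
    rw [if_neg he, flicker_theorem18M hq, show min (2 * N + 1) (2 * (N + 1)) = n by omega]

/-- **THEOREM 18 AS THE `halg` HYPOTHESIS, observable exponents** (`ℂ`-valued, (D2)'s shape with `q := Ideal.absNorm v.asIdeal` and exponent `−n`):
`(−q)^{−n} · (φ_{T_H}(n,N) − φ′_{T_H}(n,N)) = Φ_H(N)`.  [cite: Flicker1998UnitaryFL, Theorem 18 p. 97] -/
theorem flicker_theorem18n_halg (hq : 1 < q) {n N : ℕ} (hnN : n ≤ 2 * N + 1) (hpar : Even n ∨ n = 2 * N + 1) :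
    (-(q : ℂ)) ^ (-(n : ℤ)) * (((phiTHn q n N : ℚ) : ℂ) - ((phiTHprimen q n N : ℚ) : ℂ)) = ((phiHtwo q N : ℚ) : ℂ) := by
  have hq0 : (-(q : ℂ)) ≠ 0 := neg_ne_zero.2 (by exact_mod_cast (by omega : q ≠ 0))
  have h := congrArg (fun x : ℚ => (x : ℂ)) (flicker_theorem18n hq hnN hpar)
  simp only [Rat.cast_sub, Rat.cast_mul, Rat.cast_pow, Rat.cast_neg, Rat.cast_natCast] at h
  rw [zpow_neg, zpow_natCast, h, ← mul_assoc, inv_mul_cancel₀ (pow_ne_zero _ hq0), one_mul]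

end Literature.NumberTheory.Rogawski1990.Flicker1998
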